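import Literature.NumberTheory.LFunctions.LOneLowerBoundParityHalves
import Literature.NumberTheory.LFunctions.ConreyIwaniec2002Corollary63Large
import HarnessLib

/-!
# The ODD half of the Theorem-1 shape `L(1,χ) > c₁(log D)^{−A}` split by PARITY OF THE LEVEL —
# odd conductor (`−D` a prime-power-free odd fundamental discriminant, the scope of Conrey–Iwaniec
# §§7–10) / even conductor (`D = 4m`) — and the Conrey–Iwaniec kernel chain landing on the odd-level
# half: `X ∧ Corollary 10.2 ⟹ LOneLowerBoundOddOddLevel 90`, hence `X ∧ Proposition 8.1 ⟹` the same

Topic `Literature/NumberTheory/LFunctions`. DEFINITIONS + PROVED bookkeeping; nothing asserted.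
Cell landau-siegel/ls-inputs (unit `ls-inputs-I8w-typ1`, K-INPUTS-5 cascade; exponent map plan-1
A2.4, findings register F-S3/CI-(9.11)), companion of `LOneLowerBoundParityHalves.lean`.

WHY THIS FILE. The tree's odd half of the leaf, `LOneLowerBoundOdd A` (binders of
`Zhang2022.Skeleton.LOneLowerBound A` plus `χ.Odd`), quantifies over ALL moduli `D ≥ 3`, and the
CI-GAPS door of record `lOneLowerBoundOdd_of_ciGaps : conreyIwaniec2002_theorem12 → (∃ c > 0, X c) →
LOneLowerBoundOdd 90` binds Theorem 1.2 AS TYPED (no parity restriction on `q`). What the tree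
PROVES of Conrey–Iwaniec is the `q`-odd case: Corollary 10.2 (`conreyIwaniec2002_corollary102`,
`Odd q` explicit) is a kernel theorem modulo the typed Proposition 8.1 alone
(`conreyIwaniec2002_corollary102_of_proposition81`, `ConreyIwaniec2002Corollary63Large.lean`), and so
is Theorem 1.1 with exponent `−(2A+7)` (`conreyIwaniec2002_theorem11_weak_of_proposition81`); even
`q` is outside §7 and Propositions 8.1/9.1/10.1 (no printed proof). An odd real primitive character
has conductor `|d|` for a negative fundamental discriminant `d`, which is EITHER odd (`d ≡ 1 (mod 4)`,
fields `ℚ(√−q)`, `q ≡ 3 (mod 4)` squarefree) OR `4m` (`m` squarefree, `m ≢ 3 (mod 4)`: the fields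
`ℚ(√−1)`, `ℚ(√−2)`, `ℚ(√−5)`, …). Hence the honest leaf-level target of the kernel chain is the
odd-LEVEL part of the odd half; this file names the two level-halves, proves
`LOneLowerBoundOdd A ↔ LOneLowerBoundOddOddLevel A ∧ LOneLowerBoundOddEvenLevel A` and monotonicity,
and lands the chain on the odd-level half BY NAME:

* `lOneLowerBoundOddOddLevel_of_corollary102 : conreyIwaniec2002_corollary102 → (∃ c > 0, X c) →
  LOneLowerBoundOddOddLevel 90` (the conductor `D = 3`, excluded by CI's `q > 4`, is absorbed into
  the constant by `L(1,χ) ≠ 0`);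
* `lOneLowerBoundOddOddLevel_of_proposition81 : conreyIwaniec2002_proposition81 → (∃ c > 0, X c) →
  LOneLowerBoundOddOddLevel 90` — the CI-GAPS door with its fact boundary at Conrey–Iwaniec §§5–8;
* `lOneLowerBoundOddOddLevel_of_ciGaps` — the door of record restricts to the odd-level half (sanity).

The EVEN-LEVEL odd half (`LOneLowerBoundOddEvenLevel`) and the EVEN half (`LOneLowerBoundEven`) are
not touched by any Conrey–Iwaniec statement the tree proves. «The programme SEARCHES and TYPES; no
claim about Landau–Siegel zeros, Theorems 1–2 of arXiv:2211.02515 or a repaired Margin232 until a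
kernel theorem says so»; typed ≠ proved; nothing here asserts (1.22) (`X`), Proposition 8.1, or any
exceptional-zero statement.

## References
* [Zhang2022LandauSiegel] Y. Zhang, arXiv:2211.02515v1, §1 Theorem 1 (the shape `L(1,χ) > c₁(log D)^{−2022}`
  for real primitive `χ`). [held]
* [ConreyIwaniec2002] J. B. Conrey, H. Iwaniec, *Spacing of zeros of Hecke L-functions and the class
  number problem*, Acta Arith. 103 (2002) 259–312: Theorem 1.2, Corollary 10.2 (`q` odd, `q > 4`),
  Proposition 8.1, §7 ("`q` odd"). [held]
-/

noncomputable section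

namespace Literature.NumberTheory.LFunctions

/-! ### The two level-halves of the odd half -/

/-- **The odd half of the Theorem-1 shape AT ODD LEVEL**: there is an absolute `c₁ > 0` with
`c₁/(log D)^A < ‖L(1,χ)‖` for every real primitive ODD character `χ` to an ODD modulus `D ≥ 3`
(`−D` an odd fundamental discriminant; fields `ℚ(√−D)`). The binders of `LOneLowerBoundOdd A` plus
`Odd D` — the scope `q` odd of Conrey–Iwaniec §§7–10. A PREDICATE in `A`; nothing asserted.
[cite: Zhang2022LandauSiegel, §1 Theorem 1 (shape, restricted to odd χ of odd conductor)]
[cite: ConreyIwaniec2002, Corollary 10.2 (q odd)] -/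
def LOneLowerBoundOddOddLevel (A : ℕ) : Prop :=
  ∃ c₁ : ℝ, 0 < c₁ ∧ ∀ (D : ℕ) [NeZero D] (χ : DirichletCharacter ℂ D),
    3 ≤ D → Odd D → χ.IsQuadratic → χ.IsPrimitive → χ.Odd → c₁ / Real.log D ^ A < ‖χ.LFunction 1‖

/-- **The odd half of the Theorem-1 shape AT EVEN LEVEL**: the same for real primitive ODD characters
to an EVEN modulus `D ≥ 3` (`D = 4m`, `m` squarefree, `m ≢ 3 (mod 4)`; fields `ℚ(√−1)`, `ℚ(√−2)`,
`ℚ(√−5)`, …) — the part of the odd half that no `q`-odd statement of Conrey–Iwaniec reaches.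
A PREDICATE in `A`; nothing asserted.
[cite: Zhang2022LandauSiegel, §1 Theorem 1 (shape, restricted to odd χ of even conductor)] -/
def LOneLowerBoundOddEvenLevel (A : ℕ) : Prop :=
  ∃ c₁ : ℝ, 0 < c₁ ∧ ∀ (D : ℕ) [NeZero D] (χ : DirichletCharacter ℂ D),
    3 ≤ D → Even D → χ.IsQuadratic → χ.IsPrimitive → χ.Odd → c₁ / Real.log D ^ A < ‖χ.LFunction 1‖

/-- The odd half implies its odd-level part (proved, definitional).
[cite: Zhang2022LandauSiegel, §1 Theorem 1] -/
theorem lOneLowerBoundOddOddLevel_of_lOneLowerBoundOdd {A : ℕ} (h : LOneLowerBoundOdd A) :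
    LOneLowerBoundOddOddLevel A := by
  obtain ⟨c₁, hc₁, h⟩ := h
  exact ⟨c₁, hc₁, fun D _ χ hD _ hq hp ho ↦ h D χ hD hq hp ho⟩

/-- The odd half implies its even-level part (proved, definitional).
[cite: Zhang2022LandauSiegel, §1 Theorem 1] -/
theorem lOneLowerBoundOddEvenLevel_of_lOneLowerBoundOdd {A : ℕ} (h : LOneLowerBoundOdd A) :
    LOneLowerBoundOddEvenLevel A := by
  obtain ⟨c₁, hc₁, h⟩ := h
  exact ⟨c₁, hc₁, fun D _ χ hD _ hq hp ho ↦ h D χ hD hq hp ho⟩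

/-- The two level-halves reassemble the odd half (proved): every modulus is even or odd
(`Nat.even_or_odd`); take the smaller constant. [cite: Zhang2022LandauSiegel, §1 Theorem 1] -/
theorem lOneLowerBoundOdd_of_oddLevel_of_evenLevel {A : ℕ} (ho : LOneLowerBoundOddOddLevel A)
    (he : LOneLowerBoundOddEvenLevel A) : LOneLowerBoundOdd A := by
  obtain ⟨c₁, hc₁, ho⟩ := ho
  obtain ⟨c₂, hc₂, he⟩ := he
  refine ⟨min c₁ c₂, lt_min hc₁ hc₂, fun D _ χ hD hq hp hodd ↦ ?_⟩
  have hpow : 0 < Real.log (D : ℝ) ^ A := by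
    have h3 : (3 : ℝ) ≤ D := by exact_mod_cast hD
    exact pow_pos (Real.log_pos (by linarith)) A
  rcases Nat.even_or_odd D with hev | hod
  · calc min c₁ c₂ / Real.log D ^ A ≤ c₂ / Real.log D ^ A :=
          div_le_div_of_nonneg_right (min_le_right _ _) hpow.le
      _ < ‖χ.LFunction 1‖ := he D χ hD hev hq hp hodd
  · calc min c₁ c₂ / Real.log D ^ A ≤ c₁ / Real.log D ^ A :=
          div_le_div_of_nonneg_right (min_le_left _ _) hpow.le
      _ < ‖χ.LFunction 1‖ := ho D χ hD hod hq hp hodd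

/-- **Odd half = odd-level part ∧ even-level part** (proved). The Conrey–Iwaniec kernel chain closes
the odd-level conjunct only. [cite: Zhang2022LandauSiegel, §1 Theorem 1]
[cite: ConreyIwaniec2002, Corollary 10.2] -/
theorem lOneLowerBoundOdd_iff_oddLevel_and_evenLevel {A : ℕ} :
    LOneLowerBoundOdd A ↔ LOneLowerBoundOddOddLevel A ∧ LOneLowerBoundOddEvenLevel A :=
  ⟨fun h ↦ ⟨lOneLowerBoundOddOddLevel_of_lOneLowerBoundOdd h,
      lOneLowerBoundOddEvenLevel_of_lOneLowerBoundOdd h⟩,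
    fun h ↦ lOneLowerBoundOdd_of_oddLevel_of_evenLevel h.1 h.2⟩

/-- **Leaf = odd-level odd part ∧ even-level odd part ∧ even half** (proved; with
`lOneLowerBound_iff_odd_and_even`). [cite: Zhang2022LandauSiegel, §1 Theorem 1] -/
theorem lOneLowerBound_iff_oddLevel_and_evenLevel_and_even {A : ℕ} :
    Zhang2022.Skeleton.LOneLowerBound A ↔
      LOneLowerBoundOddOddLevel A ∧ LOneLowerBoundOddEvenLevel A ∧ LOneLowerBoundEven A := by
  rw [lOneLowerBound_iff_odd_and_even, lOneLowerBoundOdd_iff_oddLevel_and_evenLevel, and_assoc]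

/-- Monotonicity of the odd-level part in the exponent (proved): `log D ≥ 1` for `D ≥ 3`.
[cite: Zhang2022LandauSiegel, §1 Theorem 1] -/
theorem LOneLowerBoundOddOddLevel.mono {A B : ℕ} (hAB : A ≤ B) (h : LOneLowerBoundOddOddLevel A) :
    LOneLowerBoundOddOddLevel B := by
  obtain ⟨c₁, hc₁, h⟩ := h
  refine ⟨c₁, hc₁, fun D _ χ hD hDo hq hp ho ↦ lt_of_le_of_lt ?_ (h D χ hD hDo hq hp ho)⟩
  have h3 : (3 : ℝ) ≤ D := by exact_mod_cast hD
  have hlog : 1 ≤ Real.log (D : ℝ) := by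
    rw [← Real.log_exp 1]
    exact Real.log_le_log (Real.exp_pos 1) (by linarith [Real.exp_one_lt_d9])
  exact div_le_div_of_nonneg_left hc₁.le (by positivity) (pow_le_pow_right₀ hlog hAB)

/-- Monotonicity of the even-level part in the exponent (proved).
[cite: Zhang2022LandauSiegel, §1 Theorem 1] -/
theorem LOneLowerBoundOddEvenLevel.mono {A B : ℕ} (hAB : A ≤ B) (h : LOneLowerBoundOddEvenLevel A) :
    LOneLowerBoundOddEvenLevel B := by
  obtain ⟨c₁, hc₁, h⟩ := h
  refine ⟨c₁, hc₁, fun D _ χ hD hDe hq hp ho ↦ lt_of_le_of_lt ?_ (h D χ hD hDe hq hp ho)⟩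
  have h3 : (3 : ℝ) ≤ D := by exact_mod_cast hD
  have hlog : 1 ≤ Real.log (D : ℝ) := by
    rw [← Real.log_exp 1]
    exact Real.log_le_log (Real.exp_pos 1) (by linarith [Real.exp_one_lt_d9])
  exact div_le_div_of_nonneg_left hc₁.le (by positivity) (pow_le_pow_right₀ hlog hAB)

/-! ### The Conrey–Iwaniec kernel chain lands on the odd-level half -/

/-- At ONE modulus `D ≥ 1` the values `‖L(1,χ)‖`, `χ ≠ 1`, have a uniform positive lower bound
(finitely many characters; `L(1,χ) ≠ 0`, Mathlib `LFunction_apply_one_ne_zero`). Private copy of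
the helper in `LOneLowerBoundParityHalves` (private there). [folklore] -/
private theorem exists_lOne_lower_at' (D : ℕ) [NeZero D] :
    ∃ m : ℝ, 0 < m ∧ ∀ χ : DirichletCharacter ℂ D, χ ≠ 1 → m ≤ ‖χ.LFunction 1‖ := by
  classical
  haveI : Finite (DirichletCharacter ℂ D) := MulChar.finite
  let f : DirichletCharacter ℂ D → ℝ := fun χ ↦ if χ = 1 then 1 else ‖χ.LFunction 1‖
  have hfpos : ∀ χ, 0 < f χ := by
    intro χ
    by_cases hχ : χ = 1
    · simp [f, hχ]
    · simp only [f, hχ, if_false]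
      exact norm_pos_iff.mpr (DirichletCharacter.LFunction_apply_one_ne_zero hχ)
  obtain ⟨χ₀, hχ₀⟩ := Finite.exists_min f
  refine ⟨f χ₀, hfpos χ₀, fun χ hχ ↦ ?_⟩
  have := hχ₀ χ
  simp only [f, hχ, if_false] at this
  exact this

/-- **Corollary 10.2 (q odd) closes the ODD-LEVEL odd half of the leaf at exponent `90`** (proved
modulo the named fact `conreyIwaniec2002_corollary102`, itself a kernel theorem from the typed
Proposition 8.1): if (1.22) holds with some implied constant `c > 0` (`SubnormalGapsHypothesis c`),
then `LOneLowerBoundOddOddLevel 90`. For odd `D > 4` this is (10.15) with half its constant (strict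
inequality); the one odd conductor `D = 3 ≤ 4` (`χ₋₃`) is absorbed into the constant by
`L(1,χ) ≠ 0`. The even-level odd half and the even half are not touched. Nothing here asserts (1.22).
[cite: ConreyIwaniec2002, Corollary 10.2] -/
theorem lOneLowerBoundOddOddLevel_of_corollary102 (h102 : conreyIwaniec2002_corollary102)
    (hX : ∃ c : ℝ, 0 < c ∧ SubnormalGapsHypothesis c) : LOneLowerBoundOddOddLevel 90 := by
  obtain ⟨c, hc, hXc⟩ := hX
  obtain ⟨c', hc', h⟩ := h102 c hc
  obtain ⟨m, hm, hsmall⟩ := exists_lOne_lower_at' 3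
  refine ⟨min (c' / 2) (m / 2), by positivity, fun D _ χ hD hDodd hq hp ho ↦ ?_⟩
  have h3 : (3 : ℝ) ≤ D := by exact_mod_cast hD
  have hlog1 : 1 ≤ Real.log (D : ℝ) := by
    rw [← Real.log_exp 1]
    exact Real.log_le_log (Real.exp_pos 1) (by linarith [Real.exp_one_lt_d9])
  have hpow1 : 1 ≤ Real.log (D : ℝ) ^ 90 := one_le_pow₀ hlog1
  have hpow : 0 < Real.log (D : ℝ) ^ 90 := by positivity
  by_cases h4 : 4 < D
  · have hci := h hXc D h4 hDodd χ hp hq ho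
    have hrpow : Real.log (D : ℝ) ^ (-(90 : ℝ)) = (Real.log (D : ℝ) ^ 90)⁻¹ := by
      rw [Real.rpow_neg (by linarith), ← Real.rpow_natCast]
      norm_num
    rw [hrpow, ← div_eq_mul_inv] at hci
    calc min (c' / 2) (m / 2) / Real.log D ^ 90 ≤ (c' / 2) / Real.log D ^ 90 :=
          div_le_div_of_nonneg_right (min_le_left _ _) hpow.le
      _ < c' / Real.log D ^ 90 := by
          apply div_lt_div_of_pos_right _ hpow
          linarith
      _ ≤ ‖χ.LFunction 1‖ := hci
  · push Not at h4
    have hD3 : D = 3 := by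
      rcases hDodd with ⟨k, hk⟩
      omega
    subst hD3
    have hχ1 : χ ≠ 1 := by
      rintro rfl
      have hcond : DirichletCharacter.conductor (1 : DirichletCharacter ℂ 3) = 3 := hp
      rw [DirichletCharacter.conductor_one] at hcond
      omega
    have hmle := hsmall χ hχ1
    calc min (c' / 2) (m / 2) / Real.log ((3 : ℕ) : ℝ) ^ 90 ≤ min (c' / 2) (m / 2) :=
          div_le_self (by positivity) hpow1
      _ ≤ m / 2 := min_le_right _ _
      _ < m := by linarith
      _ ≤ ‖χ.LFunction 1‖ := hmle

/-- **THE CI-GAPS DOOR WITH ITS FACT BOUNDARY AT PROPOSITION 8.1**: the typed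
`conreyIwaniec2002_proposition81` (Conrey–Iwaniec §§5–8, the mollified mean square — the ONE printed
input of the `q`-odd chain still typed) and `X` (some `c > 0` with `SubnormalGapsHypothesis c`) give
`LOneLowerBoundOddOddLevel 90`, via `conreyIwaniec2002_corollary102_of_proposition81` (Corollary 6.3
large range, Propositions 9.1/9.2-weak/10.1-weak, Corollary 10.2: tree theorems).
[cite: ConreyIwaniec2002, Corollary 10.2] [cite: ConreyIwaniec2002, Proposition 8.1] -/
theorem lOneLowerBoundOddOddLevel_of_proposition81 (h81 : conreyIwaniec2002_proposition81)
    (hX : ∃ c : ℝ, 0 < c ∧ SubnormalGapsHypothesis c) : LOneLowerBoundOddOddLevel 90 :=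
  lOneLowerBoundOddOddLevel_of_corollary102 (conreyIwaniec2002_corollary102_of_proposition81 h81) hX

/-- Sanity link: the door of record (`lOneLowerBoundOdd_of_ciGaps`, Theorem 1.2 AS TYPED, all
moduli) restricts to the odd-level half. [cite: ConreyIwaniec2002, Theorem 1.2] -/
theorem lOneLowerBoundOddOddLevel_of_ciGaps (hCI : conreyIwaniec2002_theorem12)
    (hX : ∃ c : ℝ, 0 < c ∧ SubnormalGapsHypothesis c) : LOneLowerBoundOddOddLevel 90 :=
  lOneLowerBoundOddOddLevel_of_lOneLowerBoundOdd (lOneLowerBoundOdd_of_ciGaps hCI hX)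

/-- **What remains of the odd half after the kernel chain** (proved bookkeeping): given `X` and the
typed Proposition 8.1, `LOneLowerBoundOdd 90` is EQUIVALENT to its even-level part
`LOneLowerBoundOddEvenLevel 90` — the conjunct outside the scope of every `q`-odd statement of
Conrey–Iwaniec. Nothing asserted about that conjunct. [cite: ConreyIwaniec2002, Corollary 10.2] -/
theorem lOneLowerBoundOdd_iff_evenLevel_of_proposition81 (h81 : conreyIwaniec2002_proposition81)
    (hX : ∃ c : ℝ, 0 < c ∧ SubnormalGapsHypothesis c) :
    LOneLowerBoundOdd 90 ↔ LOneLowerBoundOddEvenLevel 90 :=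
  ⟨lOneLowerBoundOddEvenLevel_of_lOneLowerBoundOdd,
    fun he ↦ lOneLowerBoundOdd_of_oddLevel_of_evenLevel
      (lOneLowerBoundOddOddLevel_of_proposition81 h81 hX) he⟩

end Literature.NumberTheory.LFunctions
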